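import Mathlib
import HarnessLib
import HarnessLib.Audit
import Summits.AtomisticToContinuum.Statement
import Literature.MathematicalPhysics.StatisticalMechanics.LennardJonesClusters
import Literature.MathematicalPhysics.StatisticalMechanics.HaggStacking
import Literature.MathematicalPhysics.StatisticalMechanics.BarlowStacking
import Literature.MathematicalPhysics.StatisticalMechanics.BarlowStackingEnergy
import Summits.AtomisticToContinuum.Crystallization.Theorems.ExcessDecayLiouvilleCrysEnergyLimit
import Summits.AtomisticToContinuum.Crystallization.Theorems.PricedLinkCensusChargedPeriodicIsOptimal
import Summits.AtomisticToContinuum.Crystallization.Theorems.PalmUnimodularRigidityChargedPatternCrystallizes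
import Summits.AtomisticToContinuum.Crystallization.Theorems.PricedLinkCensusStackingHingeLjRegistryDomination
import HarnessLib.Audit.Status.Attr

/-!
Route: GscTwinLoopSurgery

# Route GscTwinLoopSurgery — Shockley-loop surgery on infinite-volume LJ ground state configurations
— at most one twin wall, perfect hcp windows, P-agnostic hinge

It suffices to show X := GroundStatesChargePeriodic (the finite-N hinge, shared item
stmt-AtomisticToContinuum-2911): for every sequence of
Lennard-Jones ground states x^N in ℝ³ there is ONE periodic configuration Q such that for all R, ε >
0 a positive fraction ρ(R,ε) of the
particles, for infinitely many N, have their R-neighbourhood ε-matched both ways with an isometric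
copy of Q based at a point of Q.
X is reached at INFINITE VOLUME, on individual configurations (card gsc-dislocation-loop-surgery,
ideator-6; conforming re-filing of the
retired route GscLoopSurgery, D-0027 §2.1): let 𝔏 be the class of local limits X ⊆ ℝ³ of translated
ground-state sequences (two-way matching
on every ball, typed inline); every X ∈ 𝔏 is a hard-core canonical ground state configuration
(support LocalLimitStable); (S) LayeredWindows —
every r₀-dense X ∈ 𝔏 has at every scale an R-window (1/1000)-matched with an isometric copy of a
uniform Barlow stacking barlowStacking a h s,
(a,h) in the box B′ = {0.955 ≤ a ≤ 0.985, 0.81a ≤ h ≤ 0.8225a}, ANY Hägg word s; (L) TwinLoopLemma —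
an X ∈ 𝔏 globally (1/1000)-matched with
barlowStacking a h s under Hägg domination at (a,h) has AT MOST ONE wall {m : s(m+1) = s(m)} (two
walls are annihilated by a Shockley-partial
loop surgery of super-critical radius); (W) HcpPerfectWindows — an X ∈ 𝔏 globally (1/1000)-matched
with hcpStacking a h contains, for every
R and ε, an R-ball ε-matched with a translate of hcpStacking a h. With LjRegistryDomination (shared
certified item 3063, box B ⊇ B′) and
NoFoam (cohesion, 2912), compactness of 𝔏 under isometries, translations and local limits turns
(S)+(L)+(W) into X (support GscHingeGlue).
Lean: `∀ x : (N : ℕ) → (Fin N → EuclideanSpace ℝ (Fin 3)), (∀ N,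
Literature.MathematicalPhysics.StatisticalMechanics.IsGroundState
Literature.MathematicalPhysics.StatisticalMechanics.lennardJones (x N)) → ∃ Q :
Literature.MathematicalPhysics.StatisticalMechanics.PeriodicConfiguration 3, ∀ R ε : ℝ, 0 < R → 0 <
ε → ∃ ρ : ℝ, 0 < ρ ∧ ∃ᶠ N : ℕ in Filter.atTop, ρ * (N : ℝ) ≤ (Nat.card {i : Fin N // ∃ A :
EuclideanSpace ℝ (Fin 3) →ₗᵢ[ℝ] EuclideanSpace ℝ (Fin 3), ∃ q ∈ Q.points, (∀ s ∈ Q.points, dist s q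
≤ R → ∃ j : Fin N, dist (x N j) (x N i + A (s - q)) ≤ ε) ∧ (∀ j : Fin N, dist (x N j) (x N i) ≤ R →
∃ s ∈ Q.points, dist (x N j) (x N i + A (s - q)) ≤ ε)} : ℝ)`

## Assembly
DECIDING THEOREM (D-0027 §2.1), glue.lean, PROVED sorry-free against the sketch of the route file
(axioms propext, Classical.choice,
Quot.sound): `theorem closes : LocalLimitStable → LayeredWindows → TwinLoopLemma → HcpPerfectWindows
→ LjRegistryDomination → NoFoam →
GscHingeGlue → ChargedPeriodicIsOptimal → ChargedPatternCrystallizes → CrysEnergyLimit →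
_root_.Crystallization`. Content: GscHingeGlue applied
to the five cruxes and LocalLimitStable gives X = GroundStatesChargePeriodic;
ChargedPatternCrystallizes with the PROVED fact
LennardJonesMinimalDistance_holds gives IsCrystallizing lennardJones 3 (conjunct (ii)); for conjunct
(i) LennardJonesGroundStatesExist_holds
(proved) supplies a ground-state sequence, X charges some periodic Q, ChargedPeriodicIsOptimal makes
e(Q) the least periodic energy per particle
(IsLeast), IsLeast.csInf_eq rewrites ⨅_Q′ e(Q′) = e(Q) and CrysEnergyLimit gives E(N)/N → e(Q):
HasPeriodicGroundStateEnergy. Pure logic plus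
two proved Literature facts; the Assembly item below is the same implication as a Prop and is proved
by the same script (Sketch.lean,
`assembly_provable`). Import cone: definitions only (barlowStacking, hcpStacking, barlowCoupling,
IsHaggSeq, IsGroundState, PeriodicConfiguration)
and the two PROVED facts — no unproved named fact, staffable at open.

Rationale: WHY THIS LINE. Finite-N routes must count defects against an N^(2/3) surface budget and the sister
infinite-volume route PalmUnimodularRigidity passes to
point-stationary MEASURES; this line passes to infinite volume on individual CONFIGURATIONS: local
limits of translated ground states are
canonical ground state configurations in the sense of Radin–Sütő (Suto2011 §7,
BellissardRadinShlosman2010, GardnerRadin1979, RadinSchulman1983),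
exactly stable under every particle-conserving compact rearrangement, and that stability is TESTED
with the mesoscopic trial fields of
dislocation theory — a Shockley partial loop of radius L converts the stacking of a disc at cost O(L
log L + D·L) against a gain ∝ |J₂|L²
(Frank/Hirth–Lothe unfaulting, CaiNix2016 §11.1; the Dobrushin1973 two-wall slab argument for Ising
ground state configurations with loops as
the cylinder mantle), so two twin walls are never locally stable while one wall is parity-protected.
Imported areas: dislocation theory of
close-packed metals (partial loops, stacking-fault/twin energies), infinite-volume
ground-state-configuration theory, atomistic defect
analysis (HudsonOrtner2014, EhrlacherOrtnerShapeev2016, AyalaChoksiWirth2025 for certified LJ defect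
energetics) and the rigorous loop
estimates of GiulianiTheil2021 as nearest technique; only UPPER bounds on explicit trial fields and
|J₂| ≠ 0 with domination are used.
New in this re-filing: the Liouville crux is weakened to the window form the glue actually consumes
(provable by Caccioppoli averaging plus
harmonic stability), and the parameter box is nested inside ExcessDecayLiouville's admissible cell
so that route's HcpLiouville and
PhononStability can discharge it; the negatives 4146/3506 are steered around (energetic statements
on injective configurations, tolerance 1e−3 < η⋆).

RANKED CRUXES. #0 GroundStatesChargePeriodic (target) — (shared finite-N hinge
stmt-AtomisticToContinuum-2911) for every sequence of LJ ground states x^N in ℝ³ there is ONE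
periodic configuration Q such that for all R, ε > 0 there is ρ > 0 with, for infinitely many N, at
least ρN particles i whose R-neighbourhood is ε-matched both ways with x_i + A(Q.points − q) for
some linear isometry A and some base point q ∈ Q.points; here derived at infinite volume by
GscHingeGlue from the cruxes. (why it might fail: Needs one Q charged with density ρ(R,ε) at every
scale for infinitely many N: fails if LJ bulk minimisers are aperiodically stacked (domination
fails), if window parameters do not accumulate (excluded by compactness of B′), or if ground states
are foams (NoFoam false).) [BlancLewin2015, FlatleyTheil2015, Radin1991, Suto2011]
#2 LayeredWindows (crux) — (crux S, card items N1 + anti-foam + bounded cores folded into one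
existence statement) let X ∈ 𝔏 (local limit of translated LJ ground-state sequences, typed inline)
be a hard-core canonical GSC (no rearrangement of finitely many of its points into distinct new
positions avoiding the others lowers interactionEnergy + interaction with the rest; hypothesis here,
discharged by LocalLimitStable) which is r₀-relatively dense; then for every R > 0 there are c ∈ X,
a linear isometry A, a translation v, parameters (a,h) ∈ B′ = {191/200 ≤ a ≤ 197/200, (81/100)a ≤ h
≤ (329/400)a} and a Hägg word s such that X and A(barlowStacking a h s) + v are (1/1000)-matched
both ways on the closed ball B(c,R): every bulk local limit contains, at every scale, an essentially
perfect uniformly layered close-packed window (any stacking word). [difficulty: open-problem] (why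
it might fail: Carries the LJ physics at infinite volume: false if some r₀-dense local limit is
amorphous/polytetrahedral (icosahedral or decahedral order) or keeps strain, grain boundaries or
≳10² irregular walls at EVERY scale; B′ and η₀ = 1e−3 must fit the relaxed bulk (a* ≈ 0.9712, h*/a*
≈ 0.8163).) [Hales2012, HalesDSP2012, BlancLewin2015, FlatleyTheil2015, Suto2011,
BellissardRadinShlosman2010, CaiNix2016]
#3 TwinLoopLemma (crux) — (crux L, the card's mechanism: the critical Shockley-loop radius as a
variational TEST of an infinite-volume ground state) for (a,h) ∈ B′ with Hägg domination at (a,h) in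
the exact form delivered by LjRegistryDomination (Σ k|J_k| < ∞, J₂ < 0, Σ_(k≥3)(k−1)|J_k| ≤ |J₂|/2,
J_k = barlowCoupling lennardJones a h k), a Hägg word s and X ∈ 𝔏 a hard-core GSC GLOBALLY
(1/1000)-matched both ways with barlowStacking a h s: the wall set {m : s(m+1) = s(m)} has at most
one element. Two walls at layer distance D are removed by flipping the Hägg block between them,
realised inside a disc of radius L as ⌈D/2⌉ coaxial Shockley-partial loop dipoles (plus one glide
loop of net partial Burgers vector when D is odd, the registry mismatch being absorbed elastically):
gain ≥ (|J₂| − Σ_(k≥3)(k−1)|J_k|)·2πL²/cell ≥ |J₂|πL²/cell, cost ≤ C(D·L + L log L); one wall is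
parity-protected (odd number of walls between the far fields), hence `Subsingleton`. [deps:
LjRegistryDomination] [difficulty: XL] (why it might fail: Gain ≈ 4.5e−4·L² (two walls,
D-independent) vs cost C·D·L + C·L log L + error V″⟨|∇δ|²⟩·D·L² from δ = X − stacking (|δ| ≤ 1e−3):
needs a low-strain placement of the cylinder (equilibrium regularity / Caccioppoli) once D ≳ 20, and
O(1)/atom loop cores in the tube.) [Dobrushin1973, CaiNix2016, GiulianiTheil2021, HudsonOrtner2014,
AyalaChoksiWirth2025, BellissardRadinShlosman2010, RadinSchulman1983, PartayOrtnerCsanyi2017]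
#4 LjRegistryDomination (crux) — (shared certified-computation item stmt-AtomisticToContinuum-3063,
crux of route PoissonBesselStacking; the one unproved numerical fact the mechanism needs, filed as a
crux so it is settled early) for all (a,h) in the box B = {0.94 ≤ a ≤ 1, 0.78a ≤ h ≤ 0.85a} ⊇ B′,
with J_k = barlowCoupling lennardJones a h k: Σ k|J_k| < ∞, J₂ < 0 and Σ_(k≥3)(k−1)|J_k| ≤ |J₂|/2
(hcp-type registry favoured, all longer couplings dominated). [difficulty: L] (why it might fail:
Certified computation not yet done (Mathlib lacks Bessel K_ν; fallback: interval lattice sums with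
an r⁻⁶ tail bound): false only if J₂ ≥ 0 or the k ≥ 3 tail is mis-bounded somewhere on B — three
independent float cross-checks give margin ≈ 287 at the worst corner.) [PartayOrtnerCsanyi2017,
LoachAckland2017, Stillinger2001, FlatleyTheil2015, BlancLewin2015]
#5 HcpPerfectWindows (crux) — (crux W, weak Liouville rigidity of the hcp ground state configuration
— exactly what the glue consumes) for (a,h) ∈ B′ and X ∈ 𝔏 a hard-core GSC GLOBALLY (1/1000)-matched
both ways with hcpStacking a h: for every R and every ε > 0 some R-ball of ℝ³ carries a two-way
ε-matching of X with a translate hcpStacking a h + v. Content: X = hcp + u with |u| ≤ 1e−3 (two-way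
matching with η₀ < a/4 already excludes vacancies, interstitials, walls, dislocations, rotations,
other parameters); GSC surgery 'replace B_L by a translate of the perfect crystal, pair by pair'
bounds the excess energy in B_L by O(L²); harmonic (acoustic + optical) stability of hcp(a,h) at
amplitude 1e−3 converts excess into Σ|u_p − u_q|²; averaging over the L³/R³ disjoint R-balls gives
one with oscillation of u below ε (Poincaré on the bond graph). The exact Liouville theorem (u
constant), e.g. via ExcessDecayLiouville.HcpLiouville on its admissible window ⊇ B′-cells, implies
it. [difficulty: L] (why it might fail: Needs harmonic (acoustic + optical) stability of hcp(a,h)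
uniformly on B′ incl. ±1.6 % strained references, and the Caccioppoli step 'GSC ⇒ excess energy in
B_L is O(L²)' with a coercive nonlinear remainder at amplitude 1e−3; a soft mode at a corner of B′
breaks the averaging.) [EhrlacherOrtnerShapeev2016, HudsonOrtner2014, AyalaChoksiWirth2025,
Stillinger2001, BlancLewin2015, stmt-AtomisticToContinuum-9332, stmt-AtomisticToContinuum-9333]
#6 NoFoam (crux) — (cohesion input, re-filing of stmt-AtomisticToContinuum-2912, card item N4) there
is r₀ > 0 such that for every R > 0 and every sequence of LJ ground states x^N, the fraction of
particles i for which some point c with |c − x_i| ≤ R has no particle within distance r₀ tends to 0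
as N → ∞ (exterior surface and interior voids are o(N) at every observation scale); hence local
limits around typical particles are r₀-relatively dense — the one finite-N input of the line.
[difficulty: L] (why it might fail: Cohesion of LJ ground states is unproved beyond the minimal
distance (BlancLewin2015 §2.2; not even diam = O(N^(1/3)) is in print): sponge-like minimisers with
a positive density of r₀-voids would break it and leave the GSC statements true but unanchored at
finite N.) [BlancLewin2015, Blanc2004, Xue1997]
#9 LocalLimitStable (support) — (enabling lemma, PROVE FIRST; Radin/BRS existence of ground state
configurations in the hard-core canonical form of Suto2011 §7 Def. 4; verbatim re-filing of
stmt-AtomisticToContinuum-4193) every local limit X ∈ 𝔏 of translated LJ ground states is a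
hard-core canonical GSC: for finitely many points y₁..y_n of X and any n DISTINCT new positions
z₁..z_n avoiding X ∖ {y}, interactionEnergy(y) + Σ_i Σ'_(q ∈ X∖y) V(|y_i − q|) ≤ the same for z.
Proof: transplant the rearrangement to x^(σ j) + τ_j for j large (matching radius ≫ diam(y ∪ z),
tolerance → 0; injectivity of the competitor from LennardJonesMinimalDistance_holds; near part by
continuity of V off 0; far tails uniformly O(R⁻³) by δ-separation and |V| ≤ Cr⁻⁶; contradiction with
groundStateEnergy_lennardJones_le). [difficulty: M] [Suto2011, BellissardRadinShlosman2010,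
Radin1987, GardnerRadin1979, BlancLewin2015]
#9 GscHingeGlue (support) — (the glue of this route's mechanism, soft but long) LocalLimitStable →
LayeredWindows → TwinLoopLemma → HcpPerfectWindows → LjRegistryDomination → NoFoam →
GroundStatesChargePeriodic. Step 0: 𝔏 is invariant under linear isometries and translations
(isGroundState_comp_isometry_iff, interactionEnergy_add_const), closed under local limits (diagonal;
LennardJonesGroundStatesExist_holds pads the index set), sequentially compact (uniform δ-separation,
LennardJonesMinimalDistance_holds), and translating barlowStacking a h s by −(haggLabel s k·w + k h
e₃) gives barlowStacking a h (s(·+k)). Step 1 (uniform windows, by contradiction + compactness): ∀ R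
ε ∃ L such that every r₀-dense X ∈ 𝔏 has within distance L of every point a particle whose R-window
is ε-matched with c + A(hcpStacking a h − q), (a,h) ∈ B′ — else a limit X_∞ ∈ 𝔏 with no good window;
LayeredWindows + re-centring + limit give Y ∈ 𝔏 globally (1/1000)-matched with barlowStacking a h s,
(a,h) ∈ B′ ⊆ B; LjRegistryDomination + TwinLoopLemma give ≤ 1 wall; zooming away from it gives Z
matched with a translate of hcpStacking a h; HcpPerfectWindows gives ε-perfect windows in Z, which
pull back to X_∞ — contradiction. Step 2 (finite N): NoFoam with a diagonal R′_N → ∞ makes all but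
o(N) particles deep; local limits around deep particles are r₀-dense, so by Step 1 and compactness
every deep particle has a good window within distance L, whence ≥ N/C(L) good particles. Step 3 (one
Q): pigeonhole the window parameters over finitely many cells of B′ per (R,ε), take a cluster point
(a∞,h∞) of the chosen cells along R → ∞, ε → 0, and set Q = hcpPeriodicConfiguration a∞ h∞
(hcpPeriodicConfiguration_points). [difficulty: L] [BlancLewin2015, Suto2011, Radin1991,
HalesDSP2012]
#9 ChargedPeriodicIsOptimal (support) — (shared surgery-attainment item
stmt-AtomisticToContinuum-2913; conjunct (i) from a support statement) if a periodic configuration Q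
is charged by some sequence of LJ ground states with positive density at every scale (the conclusion
of GroundStatesChargePeriodic for this Q), then e(Q) is the least value of the energy per particle
over all periodic configurations: excise charged Q-patches and insert Q′-patches, compare with
E(M)/M → e_∞ ≤ e(Q′) (BlancLewin2015_8_holds, trial states). [difficulty: M] [BlancLewin2015]
#9 ChargedPatternCrystallizes (support) — (shared soft item stmt-AtomisticToContinuum-2916)
GroundStatesChargePeriodic → LennardJonesMinimalDistance → IsCrystallizing lennardJones 3: diagonal
extraction over scales, compactness of O(3), PeriodicConfiguration.tendsto_sum_of_eventually_near′
(in tree); the minimal-distance fact is LennardJonesMinimalDistance_holds (proved). [difficulty: M]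
[BlancLewin2015]
#9 CrysEnergyLimit (support) — (shared bookkeeping item stmt-AtomisticToContinuum-0626,
refuter-certified soft: periodisation + trial states + Fekete + LJ stability) E(N)/N → ⨅ over
periodic Q of e(Q); identifies the limit in conjunct (i). [difficulty: M] [BlancLewin2015,
Theil2006]

TWO-LAYER PLAN. Foreseen glued splits (k ≤ 3, depth 1), filed only when a crux moves. LayeredWindows
⇐ LocalBarlow (r₀-dense GSCs in 𝔏 are locally
(1/1000)-Barlow off a closed set meeting o(L³) unit cubes of B_L: soft twelve-coordination at
infinite volume, tolerance below the decahedral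
threshold η⋆ ≈ 0.0067 of DecahedralSoftShell) → AntiFoam (the defect set meets O(L²) cubes: grain
coarsening by recrystallising a ball with a
void pocket absorbing the density deficit; bounded icosahedral/decahedral cores, strain μω²R³ vs
interface γR²) → LayeredWindows.
TwinLoopLemma ⇐ LoopTrialUpperBound (energy of the explicit Volterra/Shockley trial field in the
IDEAL stacking: ≤ C·D·L + C·L log L + 2πL²·J-gain,
constants certifiable at finite L in the style of AyalaChoksiWirth2025) → LowStrainPlacement (a GSC
that is globally 1e−3-close to a stacking has,
for every L, cylinders of radius L where ⟨|∇δ|²⟩ is as small as needed — Caccioppoli from the O(L²)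
excess) → TwinLoopLemma; fallback
restatement if the D-uniformity resists: WallFreeStretches (arbitrarily long wall-free stretches),
which GscHingeGlue accepts verbatim.
HcpPerfectWindows ⇐ HcpBoxStability (harmonic acoustic + optical stability of hcp(a,h) on B′,
certified Bloch scan — or imported from
ExcessDecayLiouville.PhononStability 9333 whose admissible cell contains the diagonal cells of B′) →
CaccioppoliWindows → HcpPerfectWindows;
alternatively one Theorems file deriving it from ExcessDecayLiouville.HcpLiouville 9332 + 9333 +
'GSC ⇒ force balance'.
When NoFoam closes: a density upgrade ZeroDefectDensity would also discharge CrysEnergyLimit through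
the unimodular averaging of the sister route; not filed.

KILL CRITERIA. (i) LjRegistryDomination refuted (J₂ ≥ 0 or domination fails on B) ⇒ TwinLoopLemma's
hypothesis is empty on the physical box: close
`refuted:LjRegistryDomination` unless a P-agnostic restatement (walls := minority registry for the
winning sign) survives review. (ii) An explicit
r₀-dense local limit of LJ ground states that is not layered at some scale (amorphous /
polytetrahedral GSC) refutes LayeredWindows and every
sphere-packing-heritage route with it: close and record the witness. (iii) A soft mode of hcp(a,h)
inside B′ or a bounded non-trivial GSC
perturbation without perfect windows refutes HcpPerfectWindows ⇒ restate on a smaller box around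
(a*,h*) (route edit --restate), not a close.
(iv) NoFoam refuted ⇒ the GSC statements stay true but the assembly loses its finite-N anchor ⇒
pivot to the Palm-side anchor
(PalmUnimodularRigidity.UnimodularEnergyLowerBound makes r₀-density of minimising limits automatic)
or close `superseded --by
route-AtomisticToContinuum-PalmUnimodularRigidity`. (v) TwinLoopLemma unprovable at large D ⇒
restate as WallFreeStretches (glue unchanged in
content). Refutation of 0626/0627 kills conjunct (i) for every route; Crystallization proved
elsewhere moots this one; convergence with
PalmUnimodularRigidity on the shared hinge 2911 closes the later route `superseded`.

NOT DECOMPOSED YET. The elastic bookkeeping constants of the loop (core energy, dipole interaction,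
the ⟨residual force, δ⟩ and V″⟨|∇δ|²⟩DL² terms), the
Caccioppoli/averaging lemma shared by TwinLoopLemma and HcpPerfectWindows, the certified Bloch scan
on B′, rotations and re-centring lattice
translations in the glue, the Hausdorff-compactness and diagonal lemmas for 𝔏, the pigeonhole over
B′-cells and the cluster-point choice of
(a∞,h∞) — all layer-2 children or --supports lemmas. No third layer will be filed.

CHEAPEST FALSIFIER. (1) The certified computation 3063 (shared; three independent float cross-checks
today agree: J₂(a*,h*) = −7.255e−5, worst-corner ratio 287).
(2) The float Bloch-matrix scan of LJ-hcp already run by refuter g41-54 for item 9333 (no negative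
eigenvalue on an 8³ BZ grid up to ±2.6 %
dilation / c-strain, κ ≥ 0.28) covers B′ (±1.6 % in a, h/a ∈ [0.81, 0.8225]) — a certified version
is the child HcpBoxStability. (3) A toy check
of TwinLoopLemma's energy balance (kit, not run by this planner: the hub is compute-free for this
seat): relax a periodic LJ supercell with two
twin walls at distance D and a slipped disc of radius L between them; E(L) must turn negative at L*
≈ C·μb²/(2|J₂|) ~ 10³–10⁵ a. (4) Junk audit
done by hand: ∅ ∈ 𝔏 but fails r₀-density and global matching; coincident competitors are excluded by
injectivity + disjointness (the reason
Suto.IsGSC is NOT used: with lennardJones 0 = 0 it is false for every configuration of negative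
energy); for R ≤ 0 the window clauses are
vacuous but the glue only uses R → ∞; B′ ∋ (0.9712, 0.7929) and B′ ⊆ B checked in Lean (Checks.lean,
norm_num/nlinarith).

NUMBERS. LJ normalisation V = r⁻¹²/12 − r⁻⁶/6, r₀ = 1, min −1/12; hard core of ground states δ
(LennardJonesMinimalDistance_holds). Relaxed hcp/fcc
nearest-neighbour distance a* = (A₁₂/A₆)^(1/6) ≈ 0.9712, h* ≈ 0.7929 (h*/a* ≈ 0.8163 vs ideal √(2/3)
= 0.8165); box B′ = [0.955, 0.985] ×
[0.81a, 0.8225a] ∋ (a*,h*) with margins 0.014 / 0.006; B′ ⊆ B = [0.94,1] × [0.78a,0.85a] of 3063;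
diagonal cells of B′ satisfy
‖diag(a,a,h√1.5) − 0.97‖ ≤ 0.0226 < 1/40 (ExcessDecayLiouville's admissible window). J₂(a*,h*) ≈
−7.25e−5, |J₂|/Σ_(k≥3)(k−1)|J_k| ∈ [287, 587]
on B (three float cross-checks, uncertified); surgery gain 2|J₂|π/cell ≈ 4.5e−4 per unit disc area;
partial Burgers vector a/√3 ≈ 0.561 ≫
2η₀ = 0.002; tolerance η₀ = 1e−3 < 1/400 (perturbative basin quoted for 9332) < η⋆ ≈ 0.0067
(DecahedralSoftShell); wall relaxation
displacements ~1e−5 ≪ η₀; critical loop radius L* ~ μb²/(2|J₂|) ~ 10³–10⁵ a. Items at open: 12 (1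
target, 5 cruxes, 5 support of which 3
shared — 2913, 2916, 0626 — plus the shared target 2911 and shared crux 3063, 1 assembly); deciding
theorem over 10 of them.

DEFINITION REQUESTS. To be filed after open (convenience, not load-bearing — every signature already
elaborates): `IsLocalLimitOfGroundStates V d X` (the inline
𝔏-membership: ∃ ground states x^N, σ strictly increasing, τ_j, two-way ε-matching of x^(σ j) + τ_j
with X on every ball ‖·‖ ≤ R eventually) and
`IsHardCoreGSC V X` (canonical particle-conserving hard-core ground state configuration, Suto2011 §7
Def. 4 with distinct points; the k = n
slice of Literature.MathematicalPhysics.StatisticalMechanics.IsMuGSC without the μ-term), topic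
Literature/MathematicalPhysics/StatisticalMechanics
next to MuGroundStateConfiguration.lean (whose BallMatch / UniformlyDiscrete already cover the
matching clauses). No cite facts needed.

Novelty: Searches (2026-08-15): `lit search --hybrid "dislocation loop stacking fault ground state infinite
volume local stability Lennard-Jones crystal
twin boundary"` (12 docs, all metallurgy/defect textbooks: CaiNix2016 pp. 245/373/410, Smallman,
Kleman–Lavrentovich, Allnatt–Lidiard — no
rigorous GSC use); `lit galaxy search "Shockley partial loop" --star all` (6 rows: Smallman ×2,
CaiNix2016, MRS vol. 842, one Peierls–Nabarro
numerics pdf); `lit galaxy search "ground state configurations dislocation loop" --star all` (0);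
`lit search --source all "rigorous dislocation
loop energy lower bound … Giuliani Theil"` (searchd unavailable, rc 75); plus the gen-0 planner's
sweep of the same day (hybrid/crossref/zbMATH,
lit frontier/bridges AtomisticToContinuum: kinetic/BEC dominated) and two refuter novelty audits of
the card (R4 + refuter-12, 10:53Z:
NEW-COMBINATION; crossref/zbMATH nil for loops-as-test-perturbations).
Nearest prior art found: Dobrushin1973 (two parallel Ising walls removed by flipping a cylinder: the
template of TwinLoopLemma);
BellissardRadinShlosman2010 / Radin1987 / Suto2011 (existence and stationarity of ground state
configurations — never combined with mesoscopic
elastic test fields); CaiNix2016 §11.1 and Frank/Hirth–Lothe (Shockley partial loop nucleation,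
critical radius L* = line tension / fault
energy — physics, not proof); HudsonOrtner2014, EhrlacherOrtnerShapeev2016, AyalaChoksiWirth2025
(rigorous/certified atomistic defects as
constructed equilibria); Giulia  [refs: CaiNix2016, Dobrushin1973, BellissardRadinShlosman2010, Radin1987, Suto2011, HudsonOrtner2014, EhrlacherOrtnerShapeev2016, AyalaChoksiWirth2025, GiulianiTheil2021]

Barriers (technique_class: gsc-surgery, dislocation-loop-test-fields, local-limits): - technique_class: gsc-surgery, dislocation-loop-test-fields, local-limits
- Literature.Barriers.AtomisticToContinuum.SutoDegenerateGroundStates: not met — LJ is not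
Fourier-positive/band-limited, and 𝔏 (local limits of FREE finite ground states) is at zero pressure
where by the barrier's scope caveat no degenerate member competes; the route never argues
potential-generically: LayeredWindows/TwinLoopLemma use the LJ registry couplings J_k(a,h) and the
hard core explicitly; lesson kept: canonical GSCs include compressed crystals, hence provenance (𝔏)
is part of every hypothesis.
- Literature.Barriers.AtomisticToContinuum.KissingTwelveDegeneracy: evaded — contact counting is
never asked to select a stacking; selection enters only through |J₂| ≠ 0 with domination (tail
beyond √(8/3)·a, shared certified item 3063), and TwinLoopLemma kills walls PAIRWISE by an energy
comparison at range ≥ 2 layers.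
- Literature.Barriers.AtomisticToContinuum.ShortRangeStackingBlindness: evaded for the same reason —
the couplings J_k of the FULL r⁻⁶ tail are used, never a truncated potential (for which J_k = 0, k ≥
2, and the lemma's hypothesis J₂ < 0 is empty).
- Literature.Barriers.AtomisticToContinuum.Hubbard1978_mostHomogeneous: applies to any periodic
ansatz for the Hägg word; evaded because no periodicity of s is assumed — an aperiodic (Sturmian)
word would have walls at bounded gaps and any two of them are removed by one surgery; it bites only
if domination FAILS (then 3063 is refuted and kil

History (route lifecycle, newest last):
- 2026-08-23T13:33:06Z · DORMANT — reconciler: no traction for 6.1 d (last activity statement-attached at 2026-08-17T10:54:20Z); parked, not closed — `ledger route dormant route-AtomisticToContin (operator:999:2024579)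
- 2026-08-30T17:52:04Z · REACTIVATED (open) — reconciler: reactivated — activity statement-checked at 2026-08-30T16:52:29Z after parking at 2026-08-23T13:33:06Z (operator:999:1956869)

sub-problem: Crystallization · status: open · opened planner-plancard-AtomisticToContinuum-Crystal-9f10d64b-g2-0 2026-08-15T19:06:07Z · rev 1 · ledger route-AtomisticToContinuum-GscTwinLoopSurgery
GENERATED by the gate from the ledger (D-0016/17). Provers cite these decls: `theorem foo : Summit.AtomisticToContinuum.Crystallization.Theses.GscTwinLoopSurgery.<Decl> := …` in Summits/AtomisticToContinuum/Crystallization/Theorems/<Name>.lean.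
-/

namespace Summit.AtomisticToContinuum.Crystallization.Theses.GscTwinLoopSurgery

open scoped BigOperators Topology Manifold Classical MeasureTheory ProbabilityTheory Matrix InnerProductSpace ComplexConjugate ContinuousMap
open Filter Set Function TopologicalSpace MeasureTheory

attribute [summit_statement] _root_.Crystallization

/-- item stmt-AtomisticToContinuum-2911 · target · rank 0 · open · by planner
why it might fail: Needs one Q charged with density ρ(R,ε) at every scale for infinitely many N: fails if LJ bulk minimisers are aperiodically stacked (domination fails), if window parameters do not accumulate (excluded by compactness of B′), or if ground states are foams (NoFoam false).
sources: BlancLewin2015, FlatleyTheil2015, Radin1991, Suto2011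
[crux] (finite-N hinge; deterministic shadow of "the Benjamini–Schramm limit of the ground states
charges Q") for every sequence of LJ ground states x^N in ℝ³ there is ONE periodic configuration Q
such that for all R, ε > 0 there is ρ > 0 with, for infinitely many N, at least ρN particles i whose
R-neighbourhood x^N ∩ B_R(x_i) is ε-matched both ways with x_i + A(Q.points − q) for some linear
isometry A and some base point q ∈ Q.points (base point in Q.points, not a fixed origin: no
vertex-transitivity is forced, cf. refuter note on 0751). Weaker than BulkDefectVanish 0751
(fraction → 1, fixed HCP): positive density, frequently in N, any periodic Q. [deps:
StationaryMinimisersChargePeriodic, NoFoam] [difficulty: XL] -/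
@[route_item "route-AtomisticToContinuum-GscTwinLoopSurgery"]
def GroundStatesChargePeriodic : Prop :=
  ∀ x : (N : ℕ) → (Fin N → EuclideanSpace ℝ (Fin 3)), (∀ N, Literature.MathematicalPhysics.StatisticalMechanics.IsGroundState Literature.MathematicalPhysics.StatisticalMechanics.lennardJones (x N)) → ∃ Q : Literature.MathematicalPhysics.StatisticalMechanics.PeriodicConfiguration 3, ∀ R ε : ℝ, 0 < R → 0 < ε → ∃ ρ : ℝ, 0 < ρ ∧ ∃ᶠ N : ℕ in Filter.atTop, ρ * (N : ℝ) ≤ (Nat.card {i : Fin N // ∃ A : EuclideanSpace ℝ (Fin 3) →ₗᵢ[ℝ] EuclideanSpace ℝ (Fin 3), ∃ q ∈ Q.points, (∀ s ∈ Q.points, dist s q ≤ R → ∃ j : Fin N, dist (x N j) (x N i + A (s - q)) ≤ ε) ∧ (∀ j : Fin N, dist (x N j) (x N i) ≤ R → ∃ s ∈ Q.points, dist (x N j) (x N i + A (s - q)) ≤ ε)} : ℝ)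

/-- item stmt-AtomisticToContinuum-14083 · crux · rank 2 · open · by planner
why it might fail: Carries the LJ physics at infinite volume: false if some r₀-dense local limit is amorphous/polytetrahedral (icosahedral or decahedral order) or keeps strain, grain boundaries or ≳10² irregular walls at EVERY scale; B′ and η₀ = 1e−3 must fit the relaxed bulk (a* ≈ 0.9712, h*/a* ≈ 0.8163).
sources: Hales2012, HalesDSP2012, BlancLewin2015, FlatleyTheil2015, Suto2011, BellissardRadinShlosman2010
[crux] (crux S, card items N1 + anti-foam + bounded cores folded into one existence statement) let X
∈ 𝔏 (local limit of translated LJ ground-state sequences, typed inline) be a hard-core canonical GSC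
(no rearrangement of finitely many of its points into distinct new positions avoiding the others
lowers interactionEnergy + interaction with the rest; hypothesis here, discharged by
LocalLimitStable) which is r₀-relatively dense; then for every R > 0 there are c ∈ X, a linear
isometry A, a translation v, parameters (a,h) ∈ B′ = {191/200 ≤ a ≤ 197/200, (81/100)a ≤ h ≤
(329/400)a} and a Hägg word s such that X and A(barlowStacking a h s) + v are (1/1000)-matched both
ways on the closed ball B(c,R): every bulk local limit contains, at every scale, an essentially
perfect uniformly layered close-packed window (any stacking word). [difficulty: open-problem] -/
@[route_item "route-AtomisticToContinuum-GscTwinLoopSurgery", crux]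
def LayeredWindows : Prop :=
  ∀ X : Set (EuclideanSpace ℝ (Fin 3)), (∃ (x : (N : ℕ) → (Fin N → EuclideanSpace ℝ (Fin 3))) (σ : ℕ → ℕ) (τ : ℕ → EuclideanSpace ℝ (Fin 3)), (∀ N, Literature.MathematicalPhysics.StatisticalMechanics.IsGroundState Literature.MathematicalPhysics.StatisticalMechanics.lennardJones (x N)) ∧ StrictMono σ ∧ ∀ R ε : ℝ, 0 < ε → ∀ᶠ j : ℕ in Filter.atTop, (∀ p ∈ X, ‖p‖ ≤ R → ∃ i : Fin (σ j), dist (x (σ j) i + τ j) p ≤ ε) ∧ (∀ i : Fin (σ j), ‖x (σ j) i + τ j‖ ≤ R → ∃ p ∈ X, dist (x (σ j) i + τ j) p ≤ ε)) → (∀ (n : ℕ) (y z : Fin n → EuclideanSpace ℝ (Fin 3)), Function.Injective y → Function.Injective z → Set.range y ⊆ X → Disjoint (Set.range z) (X \ Set.range y) → Literature.MathematicalPhysics.StatisticalMechanics.interactionEnergy Literature.MathematicalPhysics.StatisticalMechanics.lennardJones y + ∑ i, ∑' q : ↥(X \ Set.range y), Literature.MathematicalPhysics.StatisticalMechanics.lennardJones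 (dist (y i) (q : EuclideanSpace ℝ (Fin 3))) ≤ Literature.MathematicalPhysics.StatisticalMechanics.interactionEnergy Literature.MathematicalPhysics.StatisticalMechanics.lennardJones z + ∑ i, ∑' q : ↥(X \ Set.range y), Literature.MathematicalPhysics.StatisticalMechanics.lennardJones (dist (z i) (q : EuclideanSpace ℝ (Fin 3)))) → ∀ r₀ : ℝ, 0 < r₀ → (∀ c : EuclideanSpace ℝ (Fin 3), ∃ q ∈ X, dist q c ≤ r₀) → ∀ R : ℝ, 0 < R → ∃ c ∈ X, ∃ (A : EuclideanSpace ℝ (Fin 3) ≃ₗᵢ[ℝ] EuclideanSpace ℝ (Fin 3)) (v : EuclideanSpace ℝ (Fin 3)) (a h : ℝ) (s : ℤ → ℤ), (191 / 200 ≤ a ∧ a ≤ 197 / 200 ∧ 81 / 100 * a ≤ h ∧ h ≤ 329 / 400 * a) ∧ Literature.MathematicalPhysics.StatisticalMechanics.IsHaggSeq s ∧ ((∀ p ∈ ((fun p => A p + v) '' Literature.MathematicalPhysics.StatisticalMechanics.barlowStacking a h s), dist p c ≤ R → ∃ q ∈ X, dist q p ≤ 1 / 1000) ∧ (∀ q ∈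 X, dist q c ≤ R → ∃ p ∈ ((fun p => A p + v) '' Literature.MathematicalPhysics.StatisticalMechanics.barlowStacking a h s), dist q p ≤ 1 / 1000))

/-- item stmt-AtomisticToContinuum-14084 · crux · rank 3 · open · by planner
why it might fail: Gain ≈ 4.5e−4·L² (two walls, D-independent) vs cost C·D·L + C·L log L + error V″⟨|∇δ|²⟩·D·L² from δ = X − stacking (|δ| ≤ 1e−3): needs a low-strain placement of the cylinder (equilibrium regularity / Caccioppoli) once D ≳ 20, and O(1)/atom loop cores in the tube.
sources: Dobrushin1973, CaiNix2016, GiulianiTheil2021, HudsonOrtner2014, AyalaChoksiWirth2025, BellissardRadinShlosman2010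
[crux] (crux L, the card's mechanism: the critical Shockley-loop radius as a variational TEST of an
infinite-volume ground state) for (a,h) ∈ B′ with Hägg domination at (a,h) in the exact form
delivered by LjRegistryDomination (Σ k|J_k| < ∞, J₂ < 0, Σ_(k≥3)(k−1)|J_k| ≤ |J₂|/2, J_k =
barlowCoupling lennardJones a h k), a Hägg word s and X ∈ 𝔏 a hard-core GSC GLOBALLY
(1/1000)-matched both ways with barlowStacking a h s: the wall set {m : s(m+1) = s(m)} has at most
one element. Two walls at layer distance D are removed by flipping the Hägg block between them,
realised inside a disc of radius L as ⌈D/2⌉ coaxial Shockley-partial loop dipoles (plus one glide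
loop of net partial Burgers vector when D is odd, the registry mismatch being absorbed elastically):
gain ≥ (|J₂| − Σ_(k≥3)(k−1)|J_k|)·2πL²/cell ≥ |J₂|πL²/cell, cost ≤ C(D·L + L log L); one wall is
parity-protected (odd number of walls between the far fields), hence `Subsingleton`. [deps:
LjRegistryDomination] [difficulty: XL] -/
@[route_item "route-AtomisticToContinuum-GscTwinLoopSurgery", crux]
def TwinLoopLemma : Prop :=
  ∀ (a h : ℝ) (s : ℤ → ℤ) (X : Set (EuclideanSpace ℝ (Fin 3))), (191 / 200 ≤ a ∧ a ≤ 197 / 200 ∧ 81 / 100 * a ≤ h ∧ h ≤ 329 / 400 * a) → Literature.MathematicalPhysics.StatisticalMechanics.IsHaggSeq s → (Summable (fun k : ℕ => (k : ℝ) * |Literature.MathematicalPhysics.StatisticalMechanics.barlowCoupling Literature.MathematicalPhysics.StatisticalMechanics.lennardJones a h k|) ∧ Literature.MathematicalPhysics.StatisticalMechanics.barlowCoupling Literature.MathematicalPhysics.StatisticalMechanics.lennardJones a h 2 < 0 ∧ ∑' k : ℕ, (if 3 ≤ k then ((k : ℝ) - 1) * |Literature.MathematicalPhysics.StatisticalMechanics.barlowCoupling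 Literature.MathematicalPhysics.StatisticalMechanics.lennardJones a h k| else 0) ≤ (1 / 2) * |Literature.MathematicalPhysics.StatisticalMechanics.barlowCoupling Literature.MathematicalPhysics.StatisticalMechanics.lennardJones a h 2|) → (∃ (x : (N : ℕ) → (Fin N → EuclideanSpace ℝ (Fin 3))) (σ : ℕ → ℕ) (τ : ℕ → EuclideanSpace ℝ (Fin 3)), (∀ N, Literature.MathematicalPhysics.StatisticalMechanics.IsGroundState Literature.MathematicalPhysics.StatisticalMechanics.lennardJones (x N)) ∧ StrictMono σ ∧ ∀ R ε : ℝ, 0 < ε → ∀ᶠ j : ℕ in Filter.atTop, (∀ p ∈ X, ‖p‖ ≤ R → ∃ i : Fin (σ j), dist (x (σ j) i + τ j) p ≤ ε) ∧ (∀ i : Fin (σ j), ‖x (σ j) i + τ j‖ ≤ R → ∃ p ∈ X, dist (x (σ j) i + τ j) p ≤ ε)) → (∀ (n : ℕ) (y z : Fin n → EuclideanSpace ℝ (Fin 3)), Function.Injective y → Function.Injective z → Set.range y ⊆ X → Disjoint (Set.range z) (X \ Set.range y) → Literature.MathematicalPhysics.StatisticalMechanics.interactionEnergy Literature.MathematicalPhysics.StatisticalMechanics.lennardJones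 y + ∑ i, ∑' q : ↥(X \ Set.range y), Literature.MathematicalPhysics.StatisticalMechanics.lennardJones (dist (y i) (q : EuclideanSpace ℝ (Fin 3))) ≤ Literature.MathematicalPhysics.StatisticalMechanics.interactionEnergy Literature.MathematicalPhysics.StatisticalMechanics.lennardJones z + ∑ i, ∑' q : ↥(X \ Set.range y), Literature.MathematicalPhysics.StatisticalMechanics.lennardJones (dist (z i) (q : EuclideanSpace ℝ (Fin 3)))) → ((∀ p ∈ Literature.MathematicalPhysics.StatisticalMechanics.barlowStacking a h s, ∃ q ∈ X, dist q p ≤ 1 / 1000) ∧ (∀ q ∈ X, ∃ p ∈ Literature.MathematicalPhysics.StatisticalMechanics.barlowStacking a h s, dist q p ≤ 1 / 1000)) → Set.Subsingleton {m : ℤ | s (m + 1) = s m}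

/-- item stmt-AtomisticToContinuum-3063 · crux · rank 4 · closed · proved by Summit.AtomisticToContinuum.Crystallization.Theorems.PricedHcpWindowsLjRegistry.stub_ljRegistryDomination @ f12a5753bbdb (prover) · by planner
why it might fail: Certified computation not yet done (Mathlib lacks Bessel K_ν; fallback: interval lattice sums with an r⁻⁶ tail bound): false only if J₂ ≥ 0 or the k ≥ 3 tail is mis-bounded somewhere on B — three independent float cross-checks give margin ≈ 287 at the worst corner.
sources: PartayOrtnerCsanyi2017, LoachAckland2017, Stillinger2001, FlatleyTheil2015, BlancLewin2015
[crux] (D) SIGN + HÄGG DOMINATION ON THE BOX (card items (1)-(2), the engine's deliverable): for all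
(a,h) ∈ B, with J_k = barlowCoupling lennardJones a h k: Σ k|J_k| < ∞, J₂ < 0, and Σ_{k≥3}
(k−1)|J_k| ≤ |J₂|/2. Numerics (ours, Bessel series cross-checked by direct sums): worst ratio
|J₂|/Σ_{k≥3}(k−1)|J_k| = 286.9 at (a,h/a) = (0.94,0.78), 428 at the HCP optimum, max J₂ = −3.68e−5
at (1,0.85). Proof route: 2-D Poisson summation ⇒ J_k = (1/covol) Σ_{ξ∈Λ*∖0} φ̂_{kh}(ξ)(1 − cos
2πξ·w) with φ̂_c(ξ) = (1/12)F₆ − (1/6)F₃, F_s(c,ξ) = (2π^s/Γ(s))(ξ/c)^{s−1}K_{s−1}(2πcξ); monotone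
bounds K_ν(z) ≤ √(π/2z)e^{−z}(1 + (4ν²−1)/8z + …) and a certified sign of the one-dimensional
combination at ξ₁ (Mathlib-friendlier fallback: Abel transform + Paley–Wiener contour shift, or
direct interval lattice sums with an r⁻⁶ tail bound). This typed statement supersedes the informal
certified-computation items 0628/0670 and is exactly the hypothesis of HaggDominationAllRanges
(0737). [difficulty: L] -/
@[route_item "route-AtomisticToContinuum-GscTwinLoopSurgery", crux]
def LjRegistryDomination : Prop :=
  ∀ a h : ℝ, 47 / 50 ≤ a → a ≤ 1 → 39 / 50 * a ≤ h → h ≤ 17 / 20 * a → Summable (fun k : ℕ => (k : ℝ) * |Literature.MathematicalPhysics.StatisticalMechanics.barlowCoupling Literature.MathematicalPhysics.StatisticalMechanics.lennardJones a h k|) ∧ Literature.MathematicalPhysics.StatisticalMechanics.barlowCoupling Literature.MathematicalPhysics.StatisticalMechanics.lennardJones a h 2 < 0 ∧ ∑' k : ℕ, (if 3 ≤ k then ((k : ℝ) - 1) * |Literature.MathematicalPhysics.StatisticalMechanics.barlowCoupling Literature.MathematicalPhysics.StatisticalMechanics.lennardJones a h k| else 0) ≤ (1 / 2) * |Literature.MathematicalPhysics.StatisticalMechanics.barlowCoupling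 Literature.MathematicalPhysics.StatisticalMechanics.lennardJones a h 2|

/-- `LjRegistryDomination` holds: proved by `Summit.AtomisticToContinuum.Crystallization.Theorems.PricedHcpWindowsLjRegistry.stub_ljRegistryDomination` @ f12a5753bbdb. -/
theorem LjRegistryDomination_holds : LjRegistryDomination := _root_.Summit.AtomisticToContinuum.Crystallization.Theorems.PricedHcpWindowsLjRegistry.stub_ljRegistryDomination

/-- item stmt-AtomisticToContinuum-14085 · crux · rank 5 · open · by planner
why it might fail: Needs harmonic (acoustic + optical) stability of hcp(a,h) uniformly on B′ incl. ±1.6 % strained references, and the Caccioppoli step 'GSC ⇒ excess energy in B_L is O(L²)' with a coercive nonlinear remainder at amplitude 1e−3; a soft mode at a corner of B′ breaks the averaging.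
sources: EhrlacherOrtnerShapeev2016, HudsonOrtner2014, AyalaChoksiWirth2025, Stillinger2001, BlancLewin2015, stmt-AtomisticToContinuum-9332
[crux] (crux W, weak Liouville rigidity of the hcp ground state configuration — exactly what the
glue consumes) for (a,h) ∈ B′ and X ∈ 𝔏 a hard-core GSC GLOBALLY (1/1000)-matched both ways with
hcpStacking a h: for every R and every ε > 0 some R-ball of ℝ³ carries a two-way ε-matching of X
with a translate hcpStacking a h + v. Content: X = hcp + u with |u| ≤ 1e−3 (two-way matching with η₀
< a/4 already excludes vacancies, interstitials, walls, dislocations, rotations, other parameters);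
GSC surgery 'replace B_L by a translate of the perfect crystal, pair by pair' bounds the excess
energy in B_L by O(L²); harmonic (acoustic + optical) stability of hcp(a,h) at amplitude 1e−3
converts excess into Σ|u_p − u_q|²; averaging over the L³/R³ disjoint R-balls gives one with
oscillation of u below ε (Poincaré on the bond graph). The exact Liouville theorem (u constant),
e.g. via ExcessDecayLiouville.HcpLiouville on its admissible window ⊇ B′-cells, implies it.
[difficulty: L] -/
@[route_item "route-AtomisticToContinuum-GscTwinLoopSurgery", crux]
def HcpPerfectWindows : Prop :=
  ∀ (a h : ℝ) (X : Set (EuclideanSpace ℝ (Fin 3))), (191 / 200 ≤ a ∧ a ≤ 197 / 200 ∧ 81 / 100 * a ≤ h ∧ h ≤ 329 / 400 * a) → (∃ (x : (N : ℕ) → (Fin N → EuclideanSpace ℝ (Fin 3))) (σ : ℕ → ℕ) (τ : ℕ → EuclideanSpace ℝ (Fin 3)), (∀ N, Literature.MathematicalPhysics.StatisticalMechanics.IsGroundState Literature.MathematicalPhysics.StatisticalMechanics.lennardJones (x N)) ∧ StrictMono σ ∧ ∀ R ε : ℝ, 0 < ε → ∀ᶠ j : ℕ in Filter.atTop, (∀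 p ∈ X, ‖p‖ ≤ R → ∃ i : Fin (σ j), dist (x (σ j) i + τ j) p ≤ ε) ∧ (∀ i : Fin (σ j), ‖x (σ j) i + τ j‖ ≤ R → ∃ p ∈ X, dist (x (σ j) i + τ j) p ≤ ε)) → (∀ (n : ℕ) (y z : Fin n → EuclideanSpace ℝ (Fin 3)), Function.Injective y → Function.Injective z → Set.range y ⊆ X → Disjoint (Set.range z) (X \ Set.range y) → Literature.MathematicalPhysics.StatisticalMechanics.interactionEnergy Literature.MathematicalPhysics.StatisticalMechanics.lennardJones y + ∑ i, ∑' q : ↥(X \ Set.range y), Literature.MathematicalPhysics.StatisticalMechanics.lennardJones (dist (y i) (q : EuclideanSpace ℝ (Fin 3))) ≤ Literature.MathematicalPhysics.StatisticalMechanics.interactionEnergy Literature.MathematicalPhysics.StatisticalMechanics.lennardJones z + ∑ i, ∑' q : ↥(X \ Set.range y), Literature.MathematicalPhysics.StatisticalMechanics.lennardJones (dist (z i) (q : EuclideanSpace ℝ (Fin 3)))) → ((∀ p ∈ Literature.MathematicalPhysics.StatisticalMechanics.hcpStacking a h, ∃ q ∈ X, dist q p ≤ 1 / 1000) ∧ (∀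 q ∈ X, ∃ p ∈ Literature.MathematicalPhysics.StatisticalMechanics.hcpStacking a h, dist q p ≤ 1 / 1000)) → ∀ R ε : ℝ, 0 < ε → ∃ c v : EuclideanSpace ℝ (Fin 3), (∀ p ∈ ((fun p => p + v) '' Literature.MathematicalPhysics.StatisticalMechanics.hcpStacking a h), dist p c ≤ R → ∃ q ∈ X, dist q p ≤ ε) ∧ (∀ q ∈ X, dist q c ≤ R → ∃ p ∈ ((fun p => p + v) '' Literature.MathematicalPhysics.StatisticalMechanics.hcpStacking a h), dist q p ≤ ε)

/-- item stmt-AtomisticToContinuum-13453 · crux · rank 6 · open · by planner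
why it might fail: Cohesion of LJ ground states is unproved beyond the minimal distance (BlancLewin2015 §2.2; not even diam = O(N^(1/3)) is in print): sponge-like minimisers with a positive density of r₀-voids would break it and leave the GSC statements true but unanchored at finite N.
sources: BlancLewin2015, Blanc2004, Xue1997
[support] (cohesion; same statement as moot item 2912, formerly a crux of
BenjaminiSchrammGroundStates and GscLoopSurgery, filed anew; DERIVED here by ExposedCostGivesNoFoam
and provable directly by exchange/deformation arguments) there is r₀ > 0 such that for every R > 0
and every sequence of LJ ground states x^N, the fraction of particles i for which some point c with
|c − x_i| ≤ R has no particle within distance r₀ tends to 0. It is the one finite-N input that makes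
every local (Benjamini–Schramm) limit of the ground states almost surely r₀-relatively dense.
[difficulty: L] -/
@[route_item "route-AtomisticToContinuum-GscTwinLoopSurgery", crux]
def NoFoam : Prop :=
  ∃ r₀ : ℝ, 0 < r₀ ∧ ∀ R : ℝ, 0 < R → ∀ x : (N : ℕ) → (Fin N → EuclideanSpace ℝ (Fin 3)), (∀ N, Literature.MathematicalPhysics.StatisticalMechanics.IsGroundState Literature.MathematicalPhysics.StatisticalMechanics.lennardJones (x N)) → Filter.Tendsto (fun N : ℕ => (Nat.card {i : Fin N // ∃ c : EuclideanSpace ℝ (Fin 3), dist c (x N i) ≤ R ∧ ∀ j : Fin N, r₀ ≤ dist c (x N j)} : ℝ) / N) Filter.atTop (nhds 0)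

/-- item stmt-AtomisticToContinuum-0626 · support · rank 9 · closed · proved by Summit.AtomisticToContinuum.Crystallization.Theorems.crysEnergyLimit_proof @ f456c3bab3f9 (prover) · by planner
sources: BlancLewin2015, Theil2006
Energetic crystallization: E(N)/N converges to the infimum over periodic (multi-lattice)
configurations of the LJ energy per particle in d = 3. Lower bound liminf ≥ ⨅ is the content ((a)
local optimality + (d) + surface term O(N^{2/3})); upper bound is filed separately. -/
@[route_item "route-AtomisticToContinuum-GscTwinLoopSurgery", crux]
def CrysEnergyLimit : Prop :=
  Filter.Tendsto (fun N : ℕ => Literature.MathematicalPhysics.StatisticalMechanics.groundStateEnergy Literature.MathematicalPhysics.StatisticalMechanics.lennardJones 3 N / N) Filter.atTop (nhds (⨅ Q : Literature.MathematicalPhysics.StatisticalMechanics.PeriodicConfiguration 3, Q.energyPerParticle Literature.MathematicalPhysics.StatisticalMechanics.lennardJones))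

/-- `CrysEnergyLimit` holds: proved by `Summit.AtomisticToContinuum.Crystallization.Theorems.crysEnergyLimit_proof` @ f456c3bab3f9. -/
theorem CrysEnergyLimit_holds : CrysEnergyLimit := _root_.Summit.AtomisticToContinuum.Crystallization.Theorems.crysEnergyLimit_proof

/-- item stmt-AtomisticToContinuum-14086 · support · rank 9 · closed · proved by Summit.AtomisticToContinuum.Crystallization.Theorems.LocalLimitStable.localLimitStable_proof @ e98e5b8a46b2 (prover) · by planner
sources: Suto2011, BellissardRadinShlosman2010, Radin1987, GardnerRadin1979, BlancLewin2015
[support] (enabling lemma, PROVE FIRST; Radin/BRS existence of ground state configurations in the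
hard-core canonical form of Suto2011 §7 Def. 4; verbatim re-filing of
stmt-AtomisticToContinuum-4193) every local limit X ∈ 𝔏 of translated LJ ground states is a
hard-core canonical GSC: for finitely many points y₁..y_n of X and any n DISTINCT new positions
z₁..z_n avoiding X ∖ {y}, interactionEnergy(y) + Σ_i Σ'_(q ∈ X∖y) V(|y_i − q|) ≤ the same for z.
Proof: transplant the rearrangement to x^(σ j) + τ_j for j large (matching radius ≫ diam(y ∪ z),
tolerance → 0; injectivity of the competitor from LennardJonesMinimalDistance_holds; near part by
continuity of V off 0; far tails uniformly O(R⁻³) by δ-separation and |V| ≤ Cr⁻⁶; contradiction with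
groundStateEnergy_lennardJones_le). [difficulty: M] -/
@[route_item "route-AtomisticToContinuum-GscTwinLoopSurgery", crux]
def LocalLimitStable : Prop :=
  ∀ X : Set (EuclideanSpace ℝ (Fin 3)), (∃ (x : (N : ℕ) → (Fin N → EuclideanSpace ℝ (Fin 3))) (σ : ℕ → ℕ) (τ : ℕ → EuclideanSpace ℝ (Fin 3)), (∀ N, Literature.MathematicalPhysics.StatisticalMechanics.IsGroundState Literature.MathematicalPhysics.StatisticalMechanics.lennardJones (x N)) ∧ StrictMono σ ∧ ∀ R ε : ℝ, 0 < ε → ∀ᶠ j : ℕ in Filter.atTop, (∀ p ∈ X, ‖p‖ ≤ R → ∃ i : Fin (σ j), dist (x (σ j) i + τ j) p ≤ ε) ∧ (∀ i : Fin (σ j), ‖x (σ j) i + τ j‖ ≤ R → ∃ p ∈ X, dist (x (σ j) i + τ j) p ≤ ε)) → (∀ (n : ℕ) (y z : Fin n → EuclideanSpace ℝ (Fin 3)), Function.Injective y → Function.Injective z → Set.range y ⊆ X → Disjoint (Set.range z) (X \ Set.range y) → Literature.MathematicalPhysics.StatisticalMechanics.interactionEnergy Literature.MathematicalPhysics.StatisticalMechanics.lennardJones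 y + ∑ i, ∑' q : ↥(X \ Set.range y), Literature.MathematicalPhysics.StatisticalMechanics.lennardJones (dist (y i) (q : EuclideanSpace ℝ (Fin 3))) ≤ Literature.MathematicalPhysics.StatisticalMechanics.interactionEnergy Literature.MathematicalPhysics.StatisticalMechanics.lennardJones z + ∑ i, ∑' q : ↥(X \ Set.range y), Literature.MathematicalPhysics.StatisticalMechanics.lennardJones (dist (z i) (q : EuclideanSpace ℝ (Fin 3))))

-- `LocalLimitStable` holds: proved by `Summit.AtomisticToContinuum.Crystallization.Theorems.LocalLimitStable.localLimitStable_proof` @ e98e5b8a46b2 (its module imports this route file, so no `_holds` link can be stated here).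

/-- item stmt-AtomisticToContinuum-14087 · support · rank 9 · closed · proved by Summit.AtomisticToContinuum.Crystallization.Theorems.gscHingeGlue_proof @ 376a7c331b59 (prover) · by planner
sources: BlancLewin2015, Suto2011, Radin1991, HalesDSP2012
[support] (the glue of this route's mechanism, soft but long) LocalLimitStable → LayeredWindows →
TwinLoopLemma → HcpPerfectWindows → LjRegistryDomination → NoFoam → GroundStatesChargePeriodic. Step
0: 𝔏 is invariant under linear isometries and translations (isGroundState_comp_isometry_iff,
interactionEnergy_add_const), closed under local limits (diagonal;
LennardJonesGroundStatesExist_holds pads the index set), sequentially compact (uniform δ-separation,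
LennardJonesMinimalDistance_holds), and translating barlowStacking a h s by −(haggLabel s k·w + k h
e₃) gives barlowStacking a h (s(·+k)). Step 1 (uniform windows, by contradiction + compactness): ∀ R
ε ∃ L such that every r₀-dense X ∈ 𝔏 has within distance L of every point a particle whose R-window
is ε-matched with c + A(hcpStacking a h − q), (a,h) ∈ B′ — else a limit X_∞ ∈ 𝔏 with no good window;
LayeredWindows + re-centring + limit give Y ∈ 𝔏 globally (1/1000)-matched with barlowStacking a h s,
(a,h) ∈ B′ ⊆ B; LjRegistryDomination + TwinLoopLemma give ≤ 1 wall; zooming away from it gives Z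
matched with a translate of hcpStacking a h; HcpPerfectWindows gives ε-perfect windows in Z, which
pull back to X_∞ — contradiction. Step 2 -/
@[route_item "route-AtomisticToContinuum-GscTwinLoopSurgery", crux]
def GscHingeGlue : Prop :=
  LocalLimitStable → LayeredWindows → TwinLoopLemma → HcpPerfectWindows → LjRegistryDomination → NoFoam → GroundStatesChargePeriodic

-- `GscHingeGlue` holds: proved by `Summit.AtomisticToContinuum.Crystallization.Theorems.gscHingeGlue_proof` @ 376a7c331b59 (its module imports this route file, so no `_holds` link can be stated here).

/-- item stmt-AtomisticToContinuum-2913 · support · rank 9 · closed · proved by Summit.AtomisticToContinuum.Crystallization.Theorems.chargedPeriodicIsOptimal_proof (prover) · by planner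
sources: BlancLewin2015
[support] (card item A3, SURGERY-ATTAINMENT; conjunct (i) from a support statement) if a periodic
configuration Q is charged by some sequence of LJ ground states with positive density at every scale
(the conclusion of GroundStatesChargePeriodic for this Q), then e(Q) is the least value of the
energy per particle over all periodic configurations. Proof sketch: if e(Q') < e(Q), pick R ≫
1/(e(Q) − e(Q')) and ε small; along the infinitely many N with ≥ ρN good particles select ≥ ρN/(C
R³) disjoint good R-balls (hard-core packing bound, in tree), excise each patch (n ≈ |Q ∩ B_R|
particles, self-energy ≥ n e(Q) − Cεn − CR², cross terms ≥ −CR² by the r⁻⁶ tail and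
LennardJonesMinimalDistance) and insert a Q'-patch of radius R − 1 with n' ≤ n particles (margin 1 ⇒
all new cross terms ≤ 0); compare E(N') ≤ E_mod with E(M)/M → e_∞ (BlancLewin2015_8_holds, proved)
and e_∞ ≤ e(Q') (trial states, 0629): 0 ≤ k[(n' − n)(e(Q') − e_∞) − n(e(Q) − e(Q')) + CR² + Cεn] +
o(N) with k ≥ cρN/R³ is absurd for R large. No Wulff shapes, no rates. [difficulty: M] -/
@[route_item "route-AtomisticToContinuum-GscTwinLoopSurgery", crux]
def ChargedPeriodicIsOptimal : Prop :=
  ∀ Q : Literature.MathematicalPhysics.StatisticalMechanics.PeriodicConfiguration 3, (∃ x : (N : ℕ) → (Fin N → EuclideanSpace ℝ (Fin 3)), (∀ N, Literature.MathematicalPhysics.StatisticalMechanics.IsGroundState Literature.MathematicalPhysics.StatisticalMechanics.lennardJones (x N)) ∧ ∀ R ε : ℝ, 0 < R → 0 < ε → ∃ ρ : ℝ, 0 < ρ ∧ ∃ᶠ N : ℕ in Filter.atTop, ρ * (N : ℝ) ≤ (Nat.card {i : Fin N // ∃ A : EuclideanSpace ℝ (Fin 3) →ₗᵢ[ℝ]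 EuclideanSpace ℝ (Fin 3), ∃ q ∈ Q.points, (∀ s ∈ Q.points, dist s q ≤ R → ∃ j : Fin N, dist (x N j) (x N i + A (s - q)) ≤ ε) ∧ (∀ j : Fin N, dist (x N j) (x N i) ≤ R → ∃ s ∈ Q.points, dist (x N j) (x N i + A (s - q)) ≤ ε)} : ℝ)) → IsLeast (Set.range fun Q' : Literature.MathematicalPhysics.StatisticalMechanics.PeriodicConfiguration 3 => Q'.energyPerParticle Literature.MathematicalPhysics.StatisticalMechanics.lennardJones) (Q.energyPerParticle Literature.MathematicalPhysics.StatisticalMechanics.lennardJones)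

/-- `ChargedPeriodicIsOptimal` holds: proved by `Summit.AtomisticToContinuum.Crystallization.Theorems.chargedPeriodicIsOptimal_proof`. -/
theorem ChargedPeriodicIsOptimal_holds : ChargedPeriodicIsOptimal := _root_.Summit.AtomisticToContinuum.Crystallization.Theorems.chargedPeriodicIsOptimal_proof

/-- item stmt-AtomisticToContinuum-2916 · support · rank 9 · closed · proved by Summit.AtomisticToContinuum.Crystallization.Theorems.chargedPatternCrystallizes_proof (prover) · by planner
sources: BlancLewin2015
[support] (soft) GroundStatesChargePeriodic → LennardJonesMinimalDistance → IsCrystallizing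
lennardJones 3: choose scales (k, 1/k), indices N_k ↑ with a good particle i_k, isometries A_k → A
along a subsequence (compactness of O(3)), τ_k := −x_(i_k) + alignment; the two-way matching with
minimal distance is eventually exact near every compact set, so
PeriodicConfiguration.tendsto_sum_of_eventually_near' (in tree) gives local convergence to the
periodic configuration A(Q − q) (isometryImage/translate in CrystallizationSymmetries), multiplicity
1. [difficulty: M] -/
@[route_item "route-AtomisticToContinuum-GscTwinLoopSurgery", crux]
def ChargedPatternCrystallizes : Prop :=
  GroundStatesChargePeriodic → Literature.MathematicalPhysics.StatisticalMechanics.LennardJonesMinimalDistance → Literature.MathematicalPhysics.StatisticalMechanics.IsCrystallizing Literature.MathematicalPhysics.StatisticalMechanics.lennardJones 3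

/-- `ChargedPatternCrystallizes` holds: proved by `Summit.AtomisticToContinuum.Crystallization.Theorems.chargedPatternCrystallizes_proof`. -/
theorem ChargedPatternCrystallizes_holds : ChargedPatternCrystallizes := _root_.Summit.AtomisticToContinuum.Crystallization.Theorems.chargedPatternCrystallizes_proof

/-- item stmt-AtomisticToContinuum-14088 · assembly · rank 1 · closed · proved by Summit.AtomisticToContinuum.Crystallization.Theorems.gscTwinLoopSurgery_assembly_proof @ 0dddd43f67f4 (prover) · by planner
sources: BlancLewin2015, Suto2011
[assembly] LocalLimitStable → LayeredWindows → TwinLoopLemma → HcpPerfectWindows →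
LjRegistryDomination → NoFoam → GscHingeGlue → ChargedPeriodicIsOptimal → ChargedPatternCrystallizes
→ CrysEnergyLimit → Crystallization. -/
@[route_item "route-AtomisticToContinuum-GscTwinLoopSurgery"]
def Assembly : Prop :=
  LocalLimitStable → LayeredWindows → TwinLoopLemma → HcpPerfectWindows → LjRegistryDomination → NoFoam → GscHingeGlue → ChargedPeriodicIsOptimal → ChargedPatternCrystallizes → CrysEnergyLimit → Crystallization

-- `Assembly` holds: proved by `Summit.AtomisticToContinuum.Crystallization.Theorems.gscTwinLoopSurgery_assembly_proof` @ 0dddd43f67f4 (its module imports this route file, so no `_holds` link can be stated here).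

/-! D-0027 §2.1 — DECIDING THEOREM (planner-authored via `route open/edit --closes-file`; by planner-rrepair-AtomisticToContinuum-GscTwinLo-03011c38-0 2026-08-15T19:58:15Z):
its hypotheses are this route's items and its conclusion the sub-problem Statement (glue_lint), and it elaborates with this file. -/

@[closes "route-AtomisticToContinuum-GscTwinLoopSurgery"] theorem closes : LocalLimitStable → LayeredWindows → TwinLoopLemma → HcpPerfectWindows →
    LjRegistryDomination → NoFoam → GscHingeGlue → ChargedPeriodicIsOptimal →
    ChargedPatternCrystallizes → CrysEnergyLimit → _root_.Crystallization := by
  intro hStable hWindows hLoop hHcp hDom hFoam hGlue hOpt hCharged hLim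
  -- the cruxes and the route's glue give the finite-N hinge X = GroundStatesChargePeriodic
  have hX : GroundStatesChargePeriodic := hGlue hStable hWindows hLoop hHcp hDom hFoam
  change Literature.MathematicalPhysics.StatisticalMechanics.HasPeriodicGroundStateEnergy
      Literature.MathematicalPhysics.StatisticalMechanics.lennardJones 3 ∧
    Literature.MathematicalPhysics.StatisticalMechanics.IsCrystallizing
      Literature.MathematicalPhysics.StatisticalMechanics.lennardJones 3
  refine ⟨?_, hCharged hX
    Literature.MathematicalPhysics.StatisticalMechanics.LennardJonesMinimalDistance_holds⟩
  -- conjunct (i): a ground-state sequence exists (proved fact), it charges some periodic Q,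
  -- Q attains the periodic minimum (ChargedPeriodicIsOptimal) and E(N)/N → ⨅ = e(Q) (CrysEnergyLimit)
  choose x hx using
    Literature.MathematicalPhysics.StatisticalMechanics.LennardJonesGroundStatesExist_holds
  obtain ⟨Q, hQ⟩ := hX x hx
  have hleast := hOpt Q ⟨x, hx, hQ⟩
  refine ⟨Q, hleast, ?_⟩
  have hinf : (⨅ Q' : Literature.MathematicalPhysics.StatisticalMechanics.PeriodicConfiguration 3,
      Q'.energyPerParticle Literature.MathematicalPhysics.StatisticalMechanics.lennardJones) =
      Q.energyPerParticle Literature.MathematicalPhysics.StatisticalMechanics.lennardJones :=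
    hleast.csInf_eq
  rw [← hinf]
  exact hLim

end Summit.AtomisticToContinuum.Crystallization.Theses.GscTwinLoopSurgery
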